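import Summits.QuantumAdvantage.QuantumAdvantage.Theorems.CharDialCountDialE
import HarnessLib

/-!
# CharDial ▸ CountDial, part F — real degree, relevant variables, Nisan–Szegedy (typed KNOWN fact): why `f58` is sporadic

Part F of «CountDial» (NODE-g24.md §6): `Relevant f i`, `sw_of_not_relevant` (two irrelevant coordinates are exchangeable),
`colouring_of_fewRelevant` (≤ r relevant coordinates ⟹ a few-types colouring with r+1 colours), `HasRatDeg` (the 0/1 indicator in
`lowDeg ℚ m d`), the KNOWN fact `NisanSzegedyJunta` TYPED as a Prop (a Boolean function of real degree d has ≤ d·2^{d−1} relevant variables —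
N. Nisan, M. Szegedy, *On the degree of Boolean functions as real polynomials*, Comput. Complexity 4 (1994) Thm 1.1; J. Chiarelli, P. Hatami,
M. Saks, Combinatorica 40 (2020); J. Wellens, 2022), used as a hypothesis only: `fewTypes_of_ratDeg`, `hasRatDeg_f58 : HasRatDeg f58 3`,
★ `f58_fewRelevant : NisanSzegedyJunta → #{i | Relevant f58 i} ≤ 12` — f58 lies in a FINITE family: sporadic, not the head of an infinite family.

Kernel standard: no placeholders; axioms [propext, Classical.choice, Quot.sound] only (guards at the end); closed computations by kernel `decide`.
-/

set_option autoImplicit false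
set_option linter.dupNamespace false

namespace Summit.QuantumAdvantage.QuantumAdvantage.Theorems.CountDial

open Classical
open Finset
open Summit.QuantumAdvantage.AdviceFreeQNC0
open Literature.Computability.MetaComplexity Literature.Computability.MetaComplexity.Smolensky
open Summit.QuantumAdvantage.QuantumAdvantage.Theorems.TransferDial

/-! ## §10 Real degree ⟹ few relevant variables ⟹ few types (Nisan–Szegedy, KNOWN; typed) — why `f58` is sporadic -/

section Junta
variable {m : ℕ}

/-- Coordinate `i` is RELEVANT for `f` (flipping it can change the value). -/
def Relevant (f : (Fin m → Bool) → Bool) (i : Fin m) : Prop := ∃ u : Fin m → Bool, f (Function.update u i (!u i)) ≠ f u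

/-- Flipping an irrelevant coordinate does not change the cut (either value). -/
theorem update_of_not_relevant {f : (Fin m → Bool) → Bool} {i : Fin m} (h : ¬ Relevant f i) (u : Fin m → Bool) (b : Bool) :
    f (Function.update u i b) = f u := by
  by_cases hb : b = u i
  · subst hb
    rw [Function.update_eq_self]
  · have e : b = !u i := by
      revert hb; cases b <;> cases u i <;> simp
    subst e
    by_contra hne
    exact h ⟨u, hne⟩

/-- Precomposition with the transposition `(i j)` is two coordinate updates. -/
theorem comp_swap_eq_update (u : Fin m → Bool) (i j : Fin m) :
    (u ∘ Equiv.swap i j) = Function.update (Function.update u i (u j)) j (u i) := by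
  funext k
  by_cases hki : k = i
  · subst hki
    by_cases hkj : k = j
    · subst hkj
      simp
    · rw [Function.comp_apply, Equiv.swap_apply_left, Function.update_of_ne hkj, Function.update_self]
  · by_cases hkj : k = j
    · subst hkj
      rw [Function.comp_apply, Equiv.swap_apply_right, Function.update_self]
    · rw [Function.comp_apply, Equiv.swap_apply_of_ne_of_ne hki hkj, Function.update_of_ne hkj, Function.update_of_ne hki]

/-- Two IDLE (irrelevant) coordinates are exchangeable. -/
theorem sw_of_not_relevant (f : (Fin m → Bool) → Bool) {i j : Fin m} (hi : ¬ Relevant f i) (hj : ¬ Relevant f j) : Sw f i j := by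
  intro u
  rw [comp_swap_eq_update, update_of_not_relevant hj, update_of_not_relevant hi]

/-- ★ FEW RELEVANT ⟹ FEW TYPES (kernel): `≤ r` relevant coordinates give an `(r+1)`-colouring with «same colour ⟹ exchangeable»
(idle coordinates share colour 0; relevant ones get distinct colours). -/
theorem colouring_of_fewRelevant (f : (Fin m → Bool) → Bool) {r : ℕ} (hr : (univ.filter fun i => Relevant f i).card ≤ r) :
    ∃ c : Fin m → Fin (r + 1), ∀ i j, c i = c j → Sw f i j := by
  set R : Finset (Fin m) := univ.filter fun i => Relevant f i with hR
  let e := R.equivFin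
  refine ⟨fun i => if h : i ∈ R then ⟨(e ⟨i, h⟩).val + 1, by have := (e ⟨i, h⟩).isLt; omega⟩ else 0, fun i j hij => ?_⟩
  have memR : ∀ k : Fin m, k ∈ R ↔ Relevant f k := fun k => by rw [hR, mem_filter]; simp
  by_cases hi : i ∈ R
  · by_cases hj : j ∈ R
    · simp only [hi, hj, dite_true] at hij
      have h1 : (e ⟨i, hi⟩).val = (e ⟨j, hj⟩).val := by
        have := congrArg Fin.val hij
        simpa using this
      have h2 : (⟨i, hi⟩ : R) = ⟨j, hj⟩ := e.injective (Fin.ext h1)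
      have h3 : i = j := congrArg Subtype.val h2
      subst h3
      exact sw_refl f i
    · simp only [hi, hj, dite_true, dite_false] at hij
      exact absurd (congrArg Fin.val hij) (by simp)
  · by_cases hj : j ∈ R
    · simp only [hi, hj, dite_true, dite_false] at hij
      exact absurd (congrArg Fin.val hij) (by simp)
    · exact sw_of_not_relevant f (fun h => hi ((memR i).2 h)) (fun h => hj ((memR j).2 h))

/-- REAL (`ℚ`-) degree `≤ d` of a Boolean function. -/
def HasRatDeg (f : (Fin m → Bool) → Bool) (d : ℕ) : Prop := (fun u => if f u then (1 : ℚ) else 0) ∈ lowDeg ℚ m d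

end Junta

/-- ★ KNOWN (typed fact): the Nisan–Szegedy junta theorem — a Boolean function of real degree `d` depends on at most `d·2^{d−1}`
coordinates [N. Nisan, M. Szegedy, *On the degree of Boolean functions as real polynomials*, Comput. Complexity 4 (1994), Thm 1.2/§2;
improved to `O(2^d)` by Chiarelli–Hatami–Saks, Combinatorica 40 (2020) and Wellens 2022]. -/
def NisanSzegedyJunta : Prop :=
  ∀ (m d : ℕ) (f : (Fin m → Bool) → Bool), HasRatDeg f d → (univ.filter fun i => Relevant f i).card ≤ d * 2 ^ (d - 1)

/-- ★ Real degree `d` ⟹ few types with `d·2^{d−1} + 1` colours, uniformly in `m` (kernel from the typed fact). -/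
theorem fewTypes_of_ratDeg (hNS : NisanSzegedyJunta) {m d : ℕ} (f : (Fin m → Bool) → Bool) (hf : HasRatDeg f d) :
    ∃ c : Fin m → Fin (d * 2 ^ (d - 1) + 1), ∀ i j, c i = c j → Sw f i j :=
  colouring_of_fewRelevant f (hNS m d f hf)

/-- `f58` has real degree `≤ 3` … -/
theorem hasRatDeg_f58 : HasRatDeg f58 3 := indicator_f58_mem ℚ

/-- … so it lies in the finite Nisan–Szegedy family: `≤ 12` relevant coordinates, `≤ 13` types however it is padded — SPORADIC. -/
theorem f58_fewRelevant (hNS : NisanSzegedyJunta) : (univ.filter fun i => Relevant f58 i).card ≤ 12 := hNS 9 3 f58 hasRatDeg_f58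

/-! ### Axiom guards -/

/-- info: 'Summit.QuantumAdvantage.QuantumAdvantage.Theorems.CountDial.f58_fewRelevant' depends on axioms: [propext,
 choice,
 Quot.sound] -/
#guard_msgs in #print axioms f58_fewRelevant

end Summit.QuantumAdvantage.QuantumAdvantage.Theorems.CountDial
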